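/-
COR-CM (cell pub-hodgecm2, stage 2 of the Hodge ladder) — Δ2 BRIDGE, J-column junction J2 ⇄ J3, the geometric residue `hN` of
`CorCM/D2Bridge/AlbaneseOnPieceJointlyZero.lean`: **the complex points of `(∇X) ⊗_k ℂ` are covered by the self-products
`Y_c × Y_c` of the geometric pieces** (`∇` commutes with base change on the decomposition into connected components —
[Liu2021] §2.1, used silently in the proof of Lemma 2.4 (1)).  Seat prover-pub-hodgecm2-d2bridge-prove-3-g0-0 (d2bridge-prove-3).
THEOREMS ONLY; no `sorry`; hole-free imports (Literature only; no `HodgeCM.Model.*`, no manifest path).  HC_CM is NOT proved;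
nothing here is a display or a pointer move.
-/
import Literature.NumberTheory.Automorphic.Liu2021.AlbaneseBaseChangeFiniteGalois
import Literature.NumberTheory.Automorphic.Liu2021.NablaGaloisDescent
import Literature.NumberTheory.Automorphic.Liu2021.NablaOfPieces
import Literature.NumberTheory.Automorphic.Liu2021.SplittingField
import Literature.AlgebraicGeometry.Motives.BaseChangeAlgebraicExtension
import Literature.AlgebraicGeometry.Motives.FiberBaseChange
import HarnessLib

/-!
# Δ2 bridge, J2 ⇄ J3: `(∇X)_ℂ` is covered by the `Y_c × Y_c`

For a field `k` of characteristic zero with `[Algebra k ℂ]`, `X / k` smooth projective, ANY `∇X` (`N : Nabla X`, [Liu2021]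
Def. 2.1 (1): the smallest open and closed subscheme of `X × X` containing the diagonal) and ANY colimit cofan
`inj c : Y_c ⟶ X ⊗_k ℂ` of geometrically irreducible pieces:

* `Nabla.range_map_incl_subset_of_isGalois` — over a FINITE GALOIS `L / k`: `(∇X)_L ⊆ ∇(X_L)` inside `(X × X)_L` (for any
  `∇(X_L)`).  This is the containment half of «`(∇X)_{k'} ≃ ∇_{k'}X'`» (proof of the Proposition of §2.1, l. 1194–1200) and
  is proved exactly as the tree's Galois descent `Nabla.exists_of_nabla_baseChange` (`Liu2021/NablaGaloisDescent`): `∇(X_L)` is a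
  Galois-stable clopen of `(X × X)_L`, hence the preimage of its (clopen) image `W₀ ⊆ X × X`, which contains the diagonal; the
  open subscheme on `W₀` is an open and closed subscheme through which `ΔX` factors, so `∇X ⊆ W₀` by MINIMALITY of `∇X`.
* `Nabla.exists_mem_range_tensorHom_of_isGalois` — hence, for a finite colimit cofan `e_j : E_j ⟶ X_L` of geometrically
  irreducible pieces, every point of `(∇X)_L` lies in some `e_j × e_j (E_j × E_j)` (tree `exists_tensorHom_left_eq_incl`,
  `Liu2021/NablaOfPieces`).
* `Nabla.exists_mem_range_tensorHom_baseChange_complex` — **over `ℂ`**: every point of `(∇X)_ℂ ⊆ (X × X)_ℂ` lies in the image of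
  some `inj_c × inj_c : Y_c × Y_c → (X × X)_ℂ`.  Proof: split `X` over a finite Galois `L` with pointed geometrically irreducible
  pieces `E_j` (`exists_isGalois_isColimit_isSmoothProjective_algPoints`, `Liu2021/SplittingField`), give `X_L` a `∇` (the one of
  `Albanese.exists_of_isColimit`), embed `L → ℂ` over `k`; a point `w` of `(∇X)_ℂ` maps to a point of `(∇X)_L`
  (transitivity of base change, `baseChangeHomObjIsoOfComp` and its naturality `baseChangeHomObjIsoOfComp_comm`), which lies in some
  `E_j × E_j`; so both projections of `w` lie in the CONNECTED clopen `E_j ⊗_L ℂ ⊆ X ⊗_k ℂ` (`E_j` is geometrically irreducible),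
  which lies inside a single `Y_c` (a connected set meeting an open and closed set lies inside it); hence `w ∈ Y_c × Y_c`.

Consumed by `CorCM/D2Bridge/AlbaneseOnPieceDetects.lean` (the hypothesis `hN` of `eq_zero_of_albDesc_comp_baseChange_eq_zero`).
HC_CM is NOT proved.

## References
* [Liu2021] Y. Liu, *Fourier–Jacobi cycles and arithmetic relative trace formula*, Camb. J. Math. 9 (2021) = arXiv:2102.11518:
  §2.1 Def. 2.1 (1) (FJcycle.tex l. 1171–1174), Proposition (l. 1190–1192) with proof (l. 1194–1200), proof of Lemma 2.4 (1)
  (l. 1220–1228).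
* [GortzWedhorn2020] U. Görtz, T. Wedhorn, *Algebraic Geometry I*, 2nd ed. (2020): Prop. 4.16 (transitivity of base change),
  §(14.20) and Def. 14.84 (Galois descent of closed subsets), §(3.5) Example 3.11 (coproducts), Prop. 5.50 (ii).
-/

set_option autoImplicit false

noncomputable section

open CategoryTheory CategoryTheory.Limits AlgebraicGeometry MonoidalCategory CartesianMonoidalCategory
open Literature.AlgebraicGeometry.Motives
open scoped MonObj

universe u

namespace Literature.NumberTheory.Automorphic.Liu2021.AppendixC

namespace Nabla

open AbelianVariety (bcSpec bcFunctor)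

set_option backward.isDefEq.respectTransparency false

/-! ## Pointwise helpers -/

/-- Pointwise form of an equation of composites: `g (f a) = h a` if `f ≫ g = h`. [folklore] -/
private theorem apply_apply_of_comp_eq' {A B C : Scheme.{u}} {f : A ⟶ B} {g : B ⟶ C} {h : A ⟶ C}
    (e : f ≫ g = h) (a : ↥A) : g (f a) = h a := by
  rw [← e, Scheme.Hom.comp_apply]

/-- The image of a composite lies in the image of the second map. [folklore] -/
private theorem range_comp_subset_range' {A B C : Scheme.{u}} (f : A ⟶ B) (g : B ⟶ C) :
    Set.range ⇑(f ≫ g) ⊆ Set.range ⇑g := by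
  rintro _ ⟨a, rfl⟩
  exact ⟨f a, (Scheme.Hom.comp_apply f g a).symm⟩

/-! ## Over a finite Galois extension: `(∇X)_L ⊆ ∇(X_L)` -/

section Galois

variable {k : Type u} [Field k] (L : Type u) [Field L] [Algebra k L] {X : SchemeOver k}

/-- **`(∇X)_L ⊆ ∇(X_L)` for a finite Galois `L / k`** (inside `(X × X)_L`, through `μ : X_L × X_L ⥲ (X × X)_L`): for ANY
`∇X` (`N`) and ANY `∇(X_L)` (`N'`), the image of `(∇X ↪ X × X)_L` lies in the image of `∇(X_L) ↪ X_L × X_L ⥲ (X × X)_L`.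
Galois descent of the clopen `∇(X_L)` (it is Galois-stable, `Nabla.mapsTo_gal_range_incl_μ`, hence the preimage of its clopen
image `W₀`, `GaloisDescent.preimage_image_fst_eq`) and minimality of `∇X` against the open subscheme on `W₀` — the argument of
`Nabla.exists_of_nabla_baseChange`, run for the containment. [cite: Liu2021, §2.1 Def. 2.1 (1) (FJcycle.tex l. 1171–1174) and proof of the Proposition (l. 1194–1200)]
[cite: GortzWedhorn2020, §(14.20) and Def. 14.84] -/
theorem range_map_incl_subset_of_isGalois [FiniteDimensional k L] [IsGalois k L] (N : Nabla X)
    (N' : Nabla ((bcFunctor k L).obj X)) :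
    Set.range ⇑((bcFunctor k L).map N.incl).left ⊆
      Set.range ⇑(N'.incl ≫ Functor.LaxMonoidal.μ (bcFunctor k L) X X).left := by
  haveI : IsOpenImmersion N'.incl.left := N'.isOpenImmersion_incl
  haveI : IsClosedImmersion N'.incl.left := N'.isClosedImmersion_incl
  haveI : IsIso (Functor.LaxMonoidal.μ (bcFunctor k L) X X).left :=
    ((Over.forget _).mapIso (Functor.Monoidal.μIso (bcFunctor k L) X X)).isIso_hom
  haveI : IsOpenImmersion (N'.incl ≫ Functor.LaxMonoidal.μ (bcFunctor k L) X X).left := by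
    rw [Over.comp_left]; infer_instance
  haveI : IsClosedImmersion (N'.incl ≫ Functor.LaxMonoidal.μ (bcFunctor k L) X X).left := by
    rw [Over.comp_left]; infer_instance
  -- `pr : (X × X)_L → X × X` is finite (closed) and surjective
  haveI : IsFinite (bcSpec k L) :=
    (IsFinite.SpecMap_iff _).mpr (RingHom.finite_algebraMap.mpr inferInstance)
  haveI : IsFinite (pullback.fst (X ⊗ X).hom (bcSpec k L)) :=
    MorphismProperty.pullback_fst _ _ inferInstance
  have hclosed : IsClosedMap ⇑(pullback.fst (X ⊗ X).hom (bcSpec k L)) :=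
    (pullback.fst (X ⊗ X).hom (bcSpec k L)).isClosedMap
  have hsurj : Function.Surjective ⇑(pullback.fst (X ⊗ X).hom (bcSpec k L)) :=
    (pullback.fst (X ⊗ X).hom (bcSpec k L)).surjective
  -- `W' = ∇(X_L)` in `(X × X)_L` and its image `W₀`
  obtain ⟨W', hW'⟩ : ∃ W' : Set ↥(GaloisDescent.bc L (X ⊗ X)),
      W' = Set.range ⇑(N'.incl ≫ Functor.LaxMonoidal.μ (bcFunctor k L) X X).left := ⟨_, rfl⟩
  have hW'o : IsOpen W' := hW' ▸ IsOpenImmersion.isOpen_range _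
  have hW'c : IsClosed W' := hW' ▸ (Scheme.Hom.isClosedEmbedding _).isClosed_range
  have hstab : ∀ g : L ≃ₐ[k] L, Set.MapsTo ⇑(GaloisDescent.gal L (X ⊗ X) g) W' W' := fun g => by
    rw [hW']; exact N'.mapsTo_gal_range_incl_μ L g
  have hpre := GaloisDescent.preimage_image_fst_eq L (X ⊗ X) W' hstab
  obtain ⟨W₀, hW₀⟩ : ∃ W₀ : Set ↥(X ⊗ X).left,
      W₀ = ⇑(pullback.fst (X ⊗ X).hom (bcSpec k L)) '' W' := ⟨_, rfl⟩
  have hW₀c : IsClosed W₀ := hW₀ ▸ hclosed _ hW'c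
  have hcompl : W₀ᶜ = ⇑(pullback.fst (X ⊗ X).hom (bcSpec k L)) '' W'ᶜ := by
    ext z
    constructor
    · intro hz
      obtain ⟨y, rfl⟩ := hsurj z
      exact ⟨y, fun hy => hz (hW₀ ▸ ⟨y, hy, rfl⟩), rfl⟩
    · rintro ⟨y, hy, rfl⟩ hz
      apply hy
      rw [← hpre]
      rw [hW₀] at hz
      exact hz
  have hW₀o : IsOpen W₀ := by
    rw [← compl_compl W₀, hcompl, isOpen_compl_iff]
    exact hclosed _ hW'o.isClosed_compl
  -- the diagonal of `X` lands in `W₀`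
  have hdiagμ : N'.diag ≫ N'.incl ≫ Functor.LaxMonoidal.μ (bcFunctor k L) X X =
      (bcFunctor k L).map (lift (𝟙 X) (𝟙 X)) := by
    rw [← Category.assoc, N'.diag_incl, ← Functor.Monoidal.lift_μ, CategoryTheory.Functor.map_id]
  have hΔ : Set.range ⇑(lift (𝟙 X) (𝟙 X)).left ⊆ W₀ := by
    rintro _ ⟨x, rfl⟩
    obtain ⟨x', hx'⟩ := (pullback.fst X.hom (bcSpec k L)).surjective x
    rw [hW₀]
    refine ⟨((bcFunctor k L).map (lift (𝟙 X) (𝟙 X))).left x', ?_, ?_⟩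
    · rw [hW', ← hdiagμ, Over.comp_left]
      exact range_comp_subset_range' _ _ ⟨x', rfl⟩
    · rw [← hx']
      exact apply_apply_of_comp_eq' (GaloisDescent.bcFunctor_map_left_comp_fst L (lift (𝟙 X) (𝟙 X))) x'
  -- the open and closed subscheme of `X × X` on `W₀`, through which the diagonal factors
  let U : (X ⊗ X).left.Opens := ⟨W₀, hW₀o⟩
  have hrangeU : Set.range ⇑U.ι = W₀ := Scheme.Opens.range_ι U
  haveI hUc : IsClosedImmersion U.ι :=
    IsClosedImmersion.of_isPreimmersion _ (by simpa only [hrangeU] using hW₀c)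
  have hΔ' : Set.range ⇑(lift (𝟙 X) (𝟙 X)).left ⊆ Set.range ⇑U.ι := hΔ.trans hrangeU.symm.subset
  obtain ⟨dX, hfac⟩ : ∃ dX : X.left ⟶ U, dX ≫ U.ι = (lift (𝟙 X) (𝟙 X)).left :=
    ⟨IsOpenImmersion.lift U.ι (lift (𝟙 X) (𝟙 X)).left hΔ', IsOpenImmersion.lift_fac _ _ _⟩
  let W : SchemeOver k := Over.mk (U.ι ≫ (X ⊗ X).hom)
  let j : W ⟶ X ⊗ X := Over.homMk U.ι rfl
  have hδ : ∃ δ : X ⟶ W, δ ≫ j = lift (𝟙 X) (𝟙 X) := by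
    refine ⟨Over.homMk dX ?_, Over.OverMorphism.ext hfac⟩
    change dX ≫ U.ι ≫ (X ⊗ X).hom = X.hom
    rw [← Category.assoc, hfac]
    exact Over.w (lift (𝟙 X) (𝟙 X))
  -- minimality of `∇X`: `∇X ⊆ W₀`
  obtain ⟨f, hf⟩ := N.minimal W j (inferInstanceAs (IsOpenImmersion U.ι)) hUc hδ
  have hN : Set.range ⇑N.incl.left ⊆ W₀ := by
    rw [← hrangeU, ← hf, Over.comp_left]
    exact range_comp_subset_range' _ _
  -- conclusion: `(∇X)_L = pr⁻¹(∇X) ⊆ pr⁻¹(W₀) = W' = ∇(X_L)`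
  rw [GaloisDescent.range_bcFunctor_map_left, ← hW']
  intro z hz
  have hz' : (pullback.fst (X ⊗ X).hom (bcSpec k L)) z ∈ W₀ := hN hz
  rw [hW₀] at hz'
  rw [← hpre]
  exact hz'

/-- **Every point of `(∇X)_L` lies in some `E_j × E_j`**, for a finite Galois `L / k` and a finite colimit cofan
`e_j : E_j ⟶ X_L` of geometrically irreducible pieces (given any `∇(X_L)`): `(∇X)_L ⊆ ∇(X_L)`
(`range_map_incl_subset_of_isGalois`) and `∇(X_L)` is covered by the `E_j × E_j` (`exists_tensorHom_left_eq_incl`).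
[cite: Liu2021, §2.1 Def. 2.1 (1) (FJcycle.tex l. 1171–1174) and proof of the Proposition (l. 1194–1200)] -/
theorem exists_mem_range_tensorHom_of_isGalois [FiniteDimensional k L] [IsGalois k L] (N : Nabla X)
    (N' : Nabla ((bcFunctor k L).obj X)) {C : Type u} [Finite C] {E : C → SchemeOver L}
    (e : ∀ j, E j ⟶ (bcFunctor k L).obj X) [∀ j, GeometricallyIrreducible (E j).hom]
    (hcol : IsColimit (Cofan.mk ((bcFunctor k L).obj X) e))
    {z : ↥((bcFunctor k L).obj (X ⊗ X)).left} (hz : z ∈ Set.range ⇑((bcFunctor k L).map N.incl).left) :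
    ∃ j, z ∈ Set.range ⇑((e j ⊗ₘ e j) ≫ Functor.LaxMonoidal.μ (bcFunctor k L) X X).left := by
  obtain ⟨n, hn⟩ := range_map_incl_subset_of_isGalois L N N' hz
  obtain ⟨j, y, hy⟩ := exists_tensorHom_left_eq_incl N' hcol n
  refine ⟨j, y, ?_⟩
  rw [← hn, Over.comp_left, Scheme.Hom.comp_apply, Over.comp_left, Scheme.Hom.comp_apply, hy]

end Galois

/-! ## Over `ℂ`: every point of `(∇X)_ℂ` lies in some `Y_c × Y_c` -/

section Complex

variable {k : Type} [Field k] [CharZero k] [Algebra k ℂ]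

/-- Two families of connected open-closed subsets, the first covering the space: a member of the second family lies INSIDE some
member of the first as soon as they meet (Mathlib `IsPreconnected.subset_isClopen`). [folklore] -/
private theorem subset_of_mem_of_isClopen {α : Type*} [TopologicalSpace α] {I : Type*} {A : I → Set α} {B : Set α}
    (hAc : ∀ i, IsClopen (A i)) (hBconn : _root_.IsPreconnected B) {i : I} {x : α} (hxA : x ∈ A i) (hxB : x ∈ B) :
    B ⊆ A i :=
  hBconn.subset_isClopen (hAc i) ⟨x, hxB, hxA⟩

/-- For an isomorphism `e` of schemes over a base: `e⁻¹ (e y) = y` on points. [folklore] -/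
private theorem iso_inv_left_apply {S : Scheme.{0}} {Z Z' : Over S} (e : Z ≅ Z') (y : ↥Z.left) :
    e.inv.left (e.hom.left y) = y := by
  rw [← Scheme.Hom.comp_apply, ← Over.comp_left, e.hom_inv_id, Over.id_left]; rfl

/-- For an isomorphism `e` of schemes over a base: `e (e⁻¹ y) = y` on points. [folklore] -/
private theorem iso_hom_left_apply {S : Scheme.{0}} {Z Z' : Over S} (e : Z ≅ Z') (y : ↥Z'.left) :
    e.hom.left (e.inv.left y) = y := by
  rw [← Scheme.Hom.comp_apply, ← Over.comp_left, e.inv_hom_id, Over.id_left]; rfl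

section Shadow

variable (L M : Type) [Field L] [Field M] [Algebra k L] [Algebra L M] [Algebra k M]
  (hτ : (algebraMap L M).comp (algebraMap k L) = algebraMap k M)

omit [CharZero k] [Algebra k ℂ] in
/-- **The `L`-shadow of an `M`-point is natural.**  For a tower `k → L → M` and a `k`-morphism `p : A → B`, the map
`A ⊗_k M ⥲ (A ⊗_k L) ⊗_L M → A ⊗_k L` (transitivity of base change, `baseChangeHomObjIsoOfComp`, then the projection) commutes
with `p`: naturality of the transitivity isomorphism (`baseChangeHomObjIsoOfComp_comm`) and of the projection
(`GaloisDescent.bcFunctor_map_left_comp_fst`). [cite: GortzWedhorn2020, Prop. 4.16] -/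
private theorem shadow_comm {A B : SchemeOver k} (p : A ⟶ B) (x : ↥((bcFunctor k M).obj A).left) :
    (pullback.fst ((bcFunctor k L).obj B).hom (bcSpec L M))
        ((baseChangeHomObjIsoOfComp (algebraMap k L) (algebraMap L M) (algebraMap k M) hτ B).inv.left
          (((bcFunctor k M).map p).left x)) =
      ((bcFunctor k L).map p).left
        ((pullback.fst ((bcFunctor k L).obj A).hom (bcSpec L M))
          ((baseChangeHomObjIsoOfComp (algebraMap k L) (algebraMap L M) (algebraMap k M) hτ A).inv.left x)) := by
  have hnat := baseChangeHomObjIsoOfComp_comm (algebraMap k L) (algebraMap L M) (algebraMap k M) hτ p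
  have hinv : (baseChangeHom (algebraMap k M)).map p ≫
      (baseChangeHomObjIsoOfComp (algebraMap k L) (algebraMap L M) (algebraMap k M) hτ B).inv =
      (baseChangeHomObjIsoOfComp (algebraMap k L) (algebraMap L M) (algebraMap k M) hτ A).inv ≫
        (baseChangeHom (algebraMap L M)).map ((baseChangeHom (algebraMap k L)).map p) := by
    rw [Iso.comp_inv_eq, Category.assoc, hnat, Iso.inv_hom_id_assoc]
  have h1 := congrArg (fun φ => φ.left x) hinv
  simp only [Over.comp_left, Scheme.Hom.comp_apply] at h1
  have h2 := apply_apply_of_comp_eq'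
    (GaloisDescent.bcFunctor_map_left_comp_fst M ((bcFunctor k L).map p))
    ((baseChangeHomObjIsoOfComp (algebraMap k L) (algebraMap L M) (algebraMap k M) hτ A).inv.left x)
  exact (congrArg (fun y => (pullback.fst ((bcFunctor k L).obj B).hom (bcSpec L M)) y) h1).trans h2

end Shadow

omit [CharZero k] in
/-- The image of `(f × g) ≫ μ_F : Y × Y' → (X × X)_ℂ` (`F = (·) ⊗_k ℂ`, `f : Y → X_ℂ`, `g : Y' → X_ℂ`) consists of the points whose two
projections `(pr_i)_ℂ` lie in the images of `f` and `g` (Mathlib `Scheme.Pullback.range_map`, `Functor.Monoidal.μ_fst ∕ μ_snd`). [folklore] -/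
private theorem mem_range_tensorHom_μ_iff {X : SchemeOver k} {Y Y' : SchemeOver ℂ}
    (f : Y ⟶ (bcFunctor k ℂ).obj X) (g : Y' ⟶ (bcFunctor k ℂ).obj X) (w : ↥((bcFunctor k ℂ).obj (X ⊗ X)).left) :
    w ∈ Set.range ⇑((f ⊗ₘ g) ≫ Functor.LaxMonoidal.μ (bcFunctor k ℂ) X X).left ↔
      ((bcFunctor k ℂ).map (fst X X)).left w ∈ Set.range ⇑f.left ∧
        ((bcFunctor k ℂ).map (snd X X)).left w ∈ Set.range ⇑g.left := by
  have h1 : ∀ v, ((bcFunctor k ℂ).map (fst X X)).left ((Functor.LaxMonoidal.μ (bcFunctor k ℂ) X X).left v) =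
      (fst ((bcFunctor k ℂ).obj X) ((bcFunctor k ℂ).obj X)).left v := fun v => by
    rw [← Scheme.Hom.comp_apply, ← Over.comp_left, Functor.Monoidal.μ_fst]
  have h2 : ∀ v, ((bcFunctor k ℂ).map (snd X X)).left ((Functor.LaxMonoidal.μ (bcFunctor k ℂ) X X).left v) =
      (snd ((bcFunctor k ℂ).obj X) ((bcFunctor k ℂ).obj X)).left v := fun v => by
    rw [← Scheme.Hom.comp_apply, ← Over.comp_left, Functor.Monoidal.μ_snd]
  have hrange : Set.range ⇑(f ⊗ₘ g).left =
      ⇑(fst ((bcFunctor k ℂ).obj X) ((bcFunctor k ℂ).obj X)).left ⁻¹' Set.range ⇑f.left ∩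
        ⇑(snd ((bcFunctor k ℂ).obj X) ((bcFunctor k ℂ).obj X)).left ⁻¹' Set.range ⇑g.left := by
    rw [Over.tensorHom_left]
    exact Scheme.Pullback.range_map _ _ _ _ _ _ _ _ _
  -- write `w = μ v`
  have hv : (Functor.LaxMonoidal.μ (bcFunctor k ℂ) X X).left
      ((Functor.OplaxMonoidal.δ (bcFunctor k ℂ) X X).left w) = w := by
    rw [← Scheme.Hom.comp_apply, ← Over.comp_left, Functor.Monoidal.δ_μ, Over.id_left]; rfl
  have hinj : Function.Injective ⇑(Functor.LaxMonoidal.μ (bcFunctor k ℂ) X X).left := fun a b hab => by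
    have := congrArg (fun t => (Functor.OplaxMonoidal.δ (bcFunctor k ℂ) X X).left t) hab
    simp only [← Scheme.Hom.comp_apply, ← Over.comp_left, Functor.Monoidal.μ_δ, Over.id_left] at this
    exact this
  rw [← hv, h1, h2]
  constructor
  · rintro ⟨y, hy⟩
    rw [Over.comp_left, Scheme.Hom.comp_apply] at hy
    have hmem : (Functor.OplaxMonoidal.δ (bcFunctor k ℂ) X X).left w ∈ Set.range ⇑(f ⊗ₘ g).left := ⟨y, hinj hy⟩
    rw [hrange] at hmem
    exact hmem
  · rintro ⟨ha, hb⟩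
    have hmem : (Functor.OplaxMonoidal.δ (bcFunctor k ℂ) X X).left w ∈ Set.range ⇑(f ⊗ₘ g).left := by
      rw [hrange]; exact ⟨ha, hb⟩
    obtain ⟨y, hy⟩ := hmem
    exact ⟨y, by rw [Over.comp_left, Scheme.Hom.comp_apply, hy]⟩

/-- **Every point of `(∇X)_ℂ ⊆ (X × X)_ℂ` lies in the image of some `Y_c × Y_c`.**  `k` of characteristic zero with
`[Algebra k ℂ]`, `X / k` smooth of relative dimension `d` and projective, `N` ANY `∇X`, `inj_c : Y_c ⟶ X ⊗_k ℂ` ANY colimit cofan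
of geometrically irreducible complex varieties.  See the module docstring for the proof (finite Galois splitting + transitivity of
base change + connectedness of the complexified pieces). [cite: Liu2021, §2.1 proof of the Proposition (FJcycle.tex l. 1194–1200) and proof of Lemma 2.4 (1) (l. 1220–1228)]
[cite: GortzWedhorn2020, Prop. 4.16, §(14.20), Prop. 5.50 (ii)] -/
theorem exists_mem_range_tensorHom_baseChange_complex {d : ℕ} {X : SchemeOver k} [SmoothOfRelativeDimension d X.hom]
    (hX : IsProjectiveOver X) (N : Nabla X) {κ : Type} {Y : κ → SchemeOver ℂ} (inj : ∀ c, Y c ⟶ (bcFunctor k ℂ).obj X)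
    [∀ c, GeometricallyIrreducible (Y c).hom] (hcol : IsColimit (Cofan.mk ((bcFunctor k ℂ).obj X) inj))
    (m : ↥((bcFunctor k ℂ).obj N.N).left) :
    ∃ c, ((bcFunctor k ℂ).map N.incl).left m ∈
      Set.range ⇑((inj c ⊗ₘ inj c) ≫ Functor.LaxMonoidal.μ (bcFunctor k ℂ) X X).left := by
  classical
  -- §A  split `X` over a finite Galois `L / k` with geometrically irreducible pieces; a `∇(X_L)`
  obtain ⟨L, _, _, _, _, C, _, E, e, hE, -, ⟨hcolL⟩⟩ :=
    exists_isGalois_isColimit_isSmoothProjective_algPoints (d := d) X hX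
  haveI : Fintype C := Fintype.ofFinite C
  haveI : ∀ j, GeometricallyIrreducible (E j).hom := fun j => (hE j).geometricallyIrreducible
  -- a `k`-embedding `τ : L → ℂ`
  letI : Algebra L ℂ := ((IsAlgClosed.lift : L →ₐ[k] ℂ) : L →+* ℂ).toAlgebra
  have hτ : (algebraMap L ℂ).comp (algebraMap k L) = algebraMap k ℂ := (IsAlgClosed.lift : L →ₐ[k] ℂ).comp_algebraMap
  have 𝒥L : ∀ j, Jacobian (E j) := fun j =>
    (nonempty_jacobian_of_isSmoothProjective_of_algebra_complex (hE j)).some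
  obtain ⟨a'', -, -⟩ := Albanese.exists_of_isColimit hcolL 𝒥L fun j => (hE j).geometricallyIrreducible
  -- §B  the `L`-shadow `z` of the point `w := incl_ℂ m` of `(X × X)_ℂ` lies in `(∇X)_L`
  have hzmem : (pullback.fst ((bcFunctor k L).obj (X ⊗ X)).hom (bcSpec L ℂ))
      ((baseChangeHomObjIsoOfComp (algebraMap k L) (algebraMap L ℂ) (algebraMap k ℂ) hτ (X ⊗ X)).inv.left
        (((bcFunctor k ℂ).map N.incl).left m)) ∈ Set.range ⇑((bcFunctor k L).map N.incl).left :=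
    ⟨_, (shadow_comm L ℂ hτ N.incl m).symm⟩
  -- §C  `z ∈ E_j × E_j` for some `j`; its two projections over `L`
  obtain ⟨j, y, hy⟩ := exists_mem_range_tensorHom_of_isGalois L N a''.nabla e hcolL hzmem
  have hz1 : ((bcFunctor k L).map (fst X X)).left ((pullback.fst ((bcFunctor k L).obj (X ⊗ X)).hom (bcSpec L ℂ))
      ((baseChangeHomObjIsoOfComp (algebraMap k L) (algebraMap L ℂ) (algebraMap k ℂ) hτ (X ⊗ X)).inv.left
        (((bcFunctor k ℂ).map N.incl).left m))) ∈ Set.range ⇑(e j).left := by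
    rw [← hy, ← Scheme.Hom.comp_apply, ← Over.comp_left, Category.assoc, Functor.Monoidal.μ_fst, tensorHom_fst,
      Over.comp_left, Scheme.Hom.comp_apply]
    exact ⟨_, rfl⟩
  have hz2 : ((bcFunctor k L).map (snd X X)).left ((pullback.fst ((bcFunctor k L).obj (X ⊗ X)).hom (bcSpec L ℂ))
      ((baseChangeHomObjIsoOfComp (algebraMap k L) (algebraMap L ℂ) (algebraMap k ℂ) hτ (X ⊗ X)).inv.left
        (((bcFunctor k ℂ).map N.incl).left m))) ∈ Set.range ⇑(e j).left := by
    rw [← hy, ← Scheme.Hom.comp_apply, ← Over.comp_left, Category.assoc, Functor.Monoidal.μ_snd, tensorHom_snd,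
      Over.comp_left, Scheme.Hom.comp_apply]
    exact ⟨_, rfl⟩
  -- §D  the complexified piece `f : E_j ⊗_L ℂ → X ⊗_k ℂ`: connected, containing both projections of `w`
  let f : (bcFunctor L ℂ).obj (E j) ⟶ (bcFunctor k ℂ).obj X :=
    (bcFunctor L ℂ).map (e j) ≫ (baseChangeHomObjIsoOfComp (algebraMap k L) (algebraMap L ℂ) (algebraMap k ℂ) hτ X).hom
  have hmemf : ∀ x : ↥((bcFunctor k ℂ).obj X).left,
      (pullback.fst ((bcFunctor k L).obj X).hom (bcSpec L ℂ))
        ((baseChangeHomObjIsoOfComp (algebraMap k L) (algebraMap L ℂ) (algebraMap k ℂ) hτ X).inv.left x) ∈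
          Set.range ⇑(e j).left → x ∈ Set.range ⇑f.left := by
    intro x hx
    rw [← Set.mem_preimage, ← GaloisDescent.range_bcFunctor_map_left] at hx
    obtain ⟨t, ht⟩ := hx
    refine ⟨t, ?_⟩
    change ((bcFunctor L ℂ).map (e j) ≫ _).left t = x
    rw [Over.comp_left, Scheme.Hom.comp_apply, ht]
    exact iso_hom_left_apply _ x
  have hfconn : _root_.IsPreconnected (Set.range ⇑f.left) := by
    haveI : GeometricallyIrreducible ((bcFunctor L ℂ).obj (E j)).hom := ((hE j).baseChange_obj ℂ).geometricallyIrreducible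
    haveI : IrreducibleSpace ↥((bcFunctor L ℂ).obj (E j)).left :=
      GeometricallyIrreducible.irreducibleSpace_of_subsingleton ((bcFunctor L ℂ).obj (E j)).hom
    exact (isConnected_range f.left.continuous).isPreconnected
  have hw1 : ((bcFunctor k ℂ).map (fst X X)).left (((bcFunctor k ℂ).map N.incl).left m) ∈ Set.range ⇑f.left := by
    apply hmemf
    rw [shadow_comm L ℂ hτ (fst X X)]
    exact hz1
  have hw2 : ((bcFunctor k ℂ).map (snd X X)).left (((bcFunctor k ℂ).map N.incl).left m) ∈ Set.range ⇑f.left := by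
    apply hmemf
    rw [shadow_comm L ℂ hτ (snd X X)]
    exact hz2
  -- §E  the connected `E_j ⊗ ℂ` lies inside the piece `Y_c` containing `(pr₁)_ℂ w`
  have hYclopen : ∀ c, IsClopen (Set.range ⇑(inj c).left) := fun c => isClopen_range_left_of_isColimit hcol c
  obtain ⟨c, y₁, hy₁⟩ := exists_eq_left_of_isColimit hcol
    (((bcFunctor k ℂ).map (fst X X)).left (((bcFunctor k ℂ).map N.incl).left m))
  have hsub : Set.range ⇑f.left ⊆ Set.range ⇑(inj c).left :=
    subset_of_mem_of_isClopen hYclopen hfconn ⟨y₁, hy₁⟩ hw1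
  refine ⟨c, ?_⟩
  rw [mem_range_tensorHom_μ_iff]
  exact ⟨⟨y₁, hy₁⟩, hsub hw2⟩

end Complex

end Nabla

end Literature.NumberTheory.Automorphic.Liu2021.AppendixC

end
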